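import Summits.NavierStokesRegularity.NavierStokesRegularity.Theorems.SqueezeCycleNoBlowupToClay
import HarnessLib

/-!
# Crux `PlanarEnergyAPriori` (stmt-NavierStokesRegularity-16855), route PlaneEnergyCeiling:
  the classical Leray–Hopf representative of a Kato solution ("Kato ⇒ frame solution")

Helper file for the crux item stmt-NavierStokesRegularity-16855
(`Summit.NavierStokesRegularity.NavierStokesRegularity.Theses.PlaneEnergyCeiling.PlanarEnergyAPriori`),
step 2 of the bridge `PlanarEnergyAPriori ⇒ HardyPointSink.HardyEnergyBound`: the crux
`PlanarEnergyAPriori` speaks about *frame solutions* — classical solutions `(U, P)` of unforced NS on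
`ℝ³ × [0, T)` which are Leray–Hopf on `[0, T]` from a rapidly decaying datum — while the Hardy crux of
route HardyPointSink speaks about *Kato solutions* (`IsKatoSolutionOn T ν u₀ κ`: mild, `C([0,T); L³)`,
measurable). This file packages, once and for all, the standing identification used inside
`Theorems/NoBlowupToClay.lean`, `Theorems/SqueezeCycleNoBlowupToClay.lean` (whose two elementary tools
`isLerayHopfOn_update_zero`, `forall_le_of_ae_restrict_le_of_continuousOn` are reused) and
`BoundedEnvelope.stub_clayOfBackwardBounded` (steps (1)–(7) there):

* `exists_frame_of_isKatoSolutionOn` — for `ν > 0`, a smooth divergence-free rapidly decaying datum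
  `u₀` and a Kato solution `κ` on `[0, T)`, `T > 0`, there is a frame solution `(U, P)`:
  `IsClassicalNSSolutionOn (Ico 0 T) ν 0 U P`, `IsLerayHopfOn T ν 0 u₀ U`, `U 0 = u₀`, and
  `U t = κ t` a.e. for every `t ∈ [0, T)`.

Proof (all analytic inputs are theorems of the tree). The local classical Leray–Hopf solution `v`
from `u₀` (`local_classical_lerayHopf_holds`) is a Kato solution, hence agrees a.e. with `κ`
(`kato_unique_holds`); the smooth representative `w` of `κ` on `(0, T)` (`mild_L3_smooth_holds`)
agrees with `v` pointwise on the overlap (both continuous), so `v` and `w` glue to a classical `U` on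
`[0, T)` (`IsClassicalNSSolutionOn.glue`). Kato's smoothing bound `|κ| ≤ C/√t`
(`kato_solution_le_div_sqrt_holds`) and Tao's bound near `t = 0` put `κ` in Serrin's class on every
`[0, S']`, `S' < T`, so `κ` is Leray–Hopf there (`IsKatoSolutionOn.isLerayHopfOn_of_memLp_two`) and
agrees a.e. with Leray's weak solution `u_L` from `u₀` (`weak_strong_uniqueness_holds`); grafting
`u_L` at and after `T` and transporting along the a.e. equalities (`IsLerayHopfOn.congr_ae_slices`)
makes `U` Leray–Hopf on `[0, T]` from `u₀`.

References: Leray 1934; Kato 1984 (Thms. 1, 4); Giga 1986; Lemarié-Rieusset 2016 (Thm. 15.1);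
Tao 2013 (Cor. 11.1); Serrin 1963 / Prodi 1959.
-/

noncomputable section

set_option linter.dupNamespace false -- nested layout Summit.<S>.<Sub>, Sub = S (D-0017)

open MeasureTheory TopologicalSpace Set Function Filter Metric
open _root_.Topology
open scoped ENNReal NNReal RealInnerProductSpace
open Literature.Analysis.FluidPDE

namespace Summit.NavierStokesRegularity.NavierStokesRegularity.Theorems.PlanarEnergyAPriori

/-- **The classical Leray–Hopf representative of a Kato solution ("Kato ⇒ frame solution").**
For `ν > 0`, a smooth divergence-free rapidly decaying datum `u₀`, and a Kato solution `κ` of the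
unforced Navier–Stokes system on `[0, T)`, `T > 0` (`IsKatoSolutionOn T ν u₀ κ`), there is a
classical solution `(U, P)` on `ℝ³ × [0, T)` with `U 0 = u₀`, Leray–Hopf on `[0, T]` from `u₀`, whose
slices agree with those of `κ` almost everywhere: `U t = κ t` a.e. for every `t ∈ [0, T)`.
(Local classical solution + smooth representative of `C_tL³` mild solutions glued; Leray–Hopf through
Leray's weak solution by weak–strong uniqueness in Serrin's class, fed by Kato's bound `|κ| ≤ C/√t`.)
[cite: LemarieRieusset2016, Thm. 15.1 (A)] [cite: Kato1984, Thms. 1, 4] -/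
theorem exists_frame_of_isKatoSolutionOn {ν : ℝ} (hν : 0 < ν)
    {u₀ : EuclideanSpace ℝ (Fin 3) → EuclideanSpace ℝ (Fin 3)} (hsm : ContDiff ℝ (⊤ : ℕ∞) u₀)
    (hdiv : Literature.Analysis.FluidPDE.NSWave0.IsDivFree u₀) (hdec : HasRapidSpatialDecay u₀)
    {T : ℝ} (hTpos : 0 < T) {κ : ℝ → EuclideanSpace ℝ (Fin 3) → EuclideanSpace ℝ (Fin 3)}
    (hκ : IsKatoSolutionOn T ν u₀ κ) :
    ∃ (U : ℝ → EuclideanSpace ℝ (Fin 3) → EuclideanSpace ℝ (Fin 3))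
      (P : ℝ → EuclideanSpace ℝ (Fin 3) → ℝ),
      IsClassicalNSSolutionOn (Ico 0 T) ν 0 U P ∧ IsLerayHopfOn T ν 0 u₀ U ∧ U 0 = u₀ ∧
        ∀ t ∈ Ico 0 T, U t =ᵐ[volume] κ t := by
  -- adapted from Theorems/FrozenSignCascadeBoundedEnvelopeContinuationClayOfBackwardBounded.lean
  -- (steps (1)–(7) of `BoundedEnvelope.stub_clayOfBackwardBounded`, for an arbitrary Kato solution)
  -- ### (1) the local classical Leray–Hopf solution and the datum
  obtain ⟨T₀', hT₀', v, q, hv', hv0, hvLH⟩ := local_classical_lerayHopf_holds ν hν u₀ hsm hdiv hdec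
  have hvLH' : IsLerayHopfOn T₀' ν 0 (v 0) v := by rw [hv0]; exact hvLH
  have hdecv : HasRapidSpatialDecay (v 0) := by rw [hv0]; exact hdec
  have hu₀2 : MemLp u₀ 2 volume := by
    have h := hvLH.memLp 0 ⟨le_rfl, hT₀'.le⟩
    rwa [hv0] at h
  have hdiv0 : IsWeaklyDivFree u₀ := hvLH.isWeaklyDivFree_datum hT₀'
  have hvK' : IsKatoSolutionOn T₀' ν u₀ v := by
    have h := isKatoSolutionOn_of_classical hν hT₀' hv' hvLH' hdecv
    rwa [hv0] at h
  have hu₀3 : MemLp u₀ 3 volume := hvK'.memLp_initial hT₀'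
  -- Tao's bound for `v` on `[0, T₀'/2]` (Tao 2013, Cor. 11.1)
  obtain ⟨M₁, hM₁⟩ := exists_forall_norm_le_of_tao2011 tao2011_hasBoundedSobolevNormsOn_holds hν hv'
    hvLH' hdecv (T₀' / 2) ⟨half_pos hT₀', half_lt_self hT₀'⟩
  -- shrink the local window below `T`: `T₀ := min T₀' T`
  set T₀ : ℝ := min T₀' T with hT₀_def
  have hT₀ : 0 < T₀ := lt_min hT₀' hTpos
  have hT₀T : T₀ ≤ T := min_le_right _ _
  have hT₀le : T₀ ≤ T₀' := min_le_left _ _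
  have hv : IsClassicalNSSolutionOn (Ico 0 T₀) ν 0 v q :=
    hv'.mono (Ico_subset_Ico_right hT₀le) (uniqueDiffOn_Ico 0 T₀)
  have hvK : IsKatoSolutionOn T₀ ν u₀ v := hvK'.mono hT₀le
  -- ### (3) the classical representative `U` of `κ` on `[0, T)`
  obtain ⟨w, ϖ, hw, hwκ⟩ := mild_L3_smooth_holds hν hTpos hu₀3 hdiv0 hκ.mild hκ.continuousInLpOn
    hκ.aestronglyMeasurable
  have hvκ : ∀ t ∈ Ico 0 T₀, v t =ᵐ[volume] κ t := fun t ht =>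
    IsKatoSolutionOn.ae_eq kato_unique_holds hν hvK hκ ht.1 ht.2 (ht.2.trans_le hT₀T)
  have hvw : ∀ t ∈ Ioo 0 T₀, v t = w t := by
    intro t ht
    have h1 : v t =ᵐ[volume] w t :=
      (hvκ t ⟨ht.1.le, ht.2⟩).trans (hwκ t ⟨ht.1, ht.2.trans_le hT₀T⟩).symm
    exact (Continuous.ae_eq_iff_eq volume (hv.contDiff_velocity ⟨ht.1.le, ht.2⟩).continuous
      (hw.contDiff_velocity ⟨ht.1, ht.2.trans_le hT₀T⟩).continuous).1 h1
  have hU := hv.glue hw le_rfl hT₀ hT₀T hvw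
  set U : ℝ → EuclideanSpace ℝ (Fin 3) → EuclideanSpace ℝ (Fin 3) :=
    fun t => if t < T₀ then v t else w t with hU_def
  set P : ℝ → EuclideanSpace ℝ (Fin 3) → ℝ :=
    fun t => if t < T₀ then (fun x => q t x - q t 0) else fun x => ϖ t x - ϖ t 0 with hP_def
  have hU0 : U 0 = u₀ := by simp only [hU_def, hT₀, if_true, hv0]
  have hUκ : ∀ t ∈ Ico 0 T, U t =ᵐ[volume] κ t := by
    intro t ht
    by_cases htT₀ : t < T₀
    · simp only [hU_def, htT₀, if_true]
      exact hvκ t ⟨ht.1, htT₀⟩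
    · simp only [hU_def, htT₀, if_false]
      exact hwκ t ⟨hT₀.trans_le (not_lt.1 htT₀), ht.2⟩
  have hUcont : ContinuousOn (uncurry U) (Ico 0 T ×ˢ univ) := hU.smooth_velocity.continuousOn
  have hUmeas : ∀ S : ℝ, S ≤ T →
      AEStronglyMeasurable (uncurry U) (volume.restrict (Ioo 0 S ×ˢ univ)) := fun S hS =>
    (hUcont.mono (prod_mono (Ioo_subset_Ico_self.trans (Ico_subset_Ico_right hS))
      Subset.rfl)).aestronglyMeasurable (measurableSet_Ioo.prod MeasurableSet.univ)
  -- ### (4) Kato's smoothing bound, pointwise for `U`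
  have hbound : ∀ S : ℝ, 0 < S → S < T → ∃ C : ℝ, 0 ≤ C ∧
      ∀ t ∈ Ioo 0 S, ∀ x, ‖U t x‖ ≤ C / Real.sqrt t := by
    intro S hS0 hST
    obtain ⟨C, hC⟩ := kato_solution_le_div_sqrt_holds ν T u₀ κ hν hκ S hS0 hST
    have hκS : AEStronglyMeasurable (uncurry κ) (volume.restrict (Ioo 0 S ×ˢ univ)) :=
      hκ.aestronglyMeasurable.mono_measure
        (Measure.restrict_mono (prod_mono (Ioo_subset_Ioo_right hST.le) Subset.rfl) le_rfl)
    have hae : uncurry κ =ᵐ[volume.restrict (Ioo 0 S ×ˢ univ)] uncurry U :=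
      ae_restrict_prod_of_forall_ae_eq (fun t ht => (hUκ t ⟨ht.1.le, ht.2.trans hST⟩).symm) hκS
        (hUmeas S hST.le)
    have hC' : ∀ᵐ z ∂(volume.restrict (Ioo 0 S ×ˢ (univ : Set (EuclideanSpace ℝ (Fin 3))))),
        ‖uncurry U z‖ ≤ |C| / Real.sqrt z.1 := by
      filter_upwards [hC, hae] with z hz hzU
      calc ‖uncurry U z‖ = ‖κ z.1 z.2‖ := by rw [← hzU]; rfl
        _ ≤ C / Real.sqrt z.1 := hz
        _ ≤ |C| / Real.sqrt z.1 := by gcongr; exact le_abs_self C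
    have hO : IsOpen (Ioo (0 : ℝ) S ×ˢ (univ : Set (EuclideanSpace ℝ (Fin 3)))) :=
      isOpen_Ioo.prod isOpen_univ
    have hf : ContinuousOn (fun z : ℝ × EuclideanSpace ℝ (Fin 3) => ‖uncurry U z‖)
        (Ioo 0 S ×ˢ univ) :=
      (hUcont.mono (prod_mono (Ioo_subset_Ico_self.trans (Ico_subset_Ico_right hST.le))
        Subset.rfl)).norm
    have hg : ContinuousOn (fun z : ℝ × EuclideanSpace ℝ (Fin 3) => |C| / Real.sqrt z.1)
        (Ioo 0 S ×ˢ univ) := by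
      exact continuousOn_const.div (Real.continuous_sqrt.comp_continuousOn continuousOn_fst)
        fun z hz => (Real.sqrt_pos.2 hz.1.1).ne'
    exact ⟨|C|, abs_nonneg C, fun t ht x =>
      forall_le_of_ae_restrict_le_of_continuousOn hO hf hg hC' (t, x) ⟨ht, mem_univ x⟩⟩
  -- ### (6) `κ` is Leray–Hopf on `[0, S']` and agrees with Leray's weak solution
  obtain ⟨uL, huL⟩ := leray_existence_R3_holds ν hν u₀ hu₀2 hdiv0
  have hLae : ∀ t ∈ Ioo 0 T, uL t =ᵐ[volume] U t := by
    intro t ht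
    set S' : ℝ := (t + T) / 2 with hS'_def  -- horizons `t < S' < S < T`
    set S : ℝ := (S' + T) / 2 with hS_def
    have htS' : t < S' := by rw [hS'_def]; linarith [ht.2]
    have hS'T : S' < T := by rw [hS'_def]; linarith [ht.2]
    have hS'0 : 0 < S' := ht.1.trans htS'
    have hS'S : S' < S := by rw [hS_def]; linarith
    have hST : S < T := by rw [hS_def]; linarith
    obtain ⟨C, hC0, hC⟩ := hbound S (hS'0.trans hS'S) hST
    -- Kato's smoothing hypothesis on `(0, S)` for `κ`
    have hinf : ∀ s ∈ Ioo 0 S, eLpNorm (κ s) ∞ volume ≤ ENNReal.ofReal (C / Real.sqrt s) := by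
      intro s hs
      rw [eLpNorm_congr_ae (hUκ s ⟨hs.1.le, hs.2.trans hST⟩).symm, eLpNorm_exponent_top]
      exact eLpNormEssSup_le_of_ae_bound (Eventually.of_forall fun x => hC s hs x)
    have hκLH : IsLerayHopfOn S' ν 0 u₀ κ :=
      ((hκ.mono hST.le).isLerayHopfOn_of_memLp_two hν hu₀2 hinf hS'S hS'0).1
    -- Serrin's class `L^∞(0, S'; L^∞)`: Tao's bound on `(0, min (T₀'/2) S')`, Kato's bound after
    set M : ℝ := max M₁ (C / Real.sqrt (min (T₀' / 2) T₀)) with hM_def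
    have hmpos : 0 < min (T₀' / 2) T₀ := lt_min (half_pos hT₀') hT₀
    have hUM : ∀ s ∈ Ioo 0 S', ∀ x, ‖U s x‖ ≤ M := by
      intro s hs x
      by_cases hs2 : s < min (T₀' / 2) T₀
      · have hsT₀ : s < T₀ := hs2.trans_le (min_le_right _ _)
        have hs2' : s ≤ T₀' / 2 := (hs2.trans_le (min_le_left _ _)).le
        have hUs : U s = v s := by simp only [hU_def, hsT₀, if_true]
        rw [hUs]
        exact (hM₁ s ⟨hs.1.le, hs2'⟩ x).trans (le_max_left _ _)
      · push Not at hs2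
        have h1 : ‖U s x‖ ≤ C / Real.sqrt s := hC s ⟨hs.1, hs.2.trans hS'S⟩ x
        have h2 : C / Real.sqrt s ≤ C / Real.sqrt (min (T₀' / 2) T₀) := by
          apply div_le_div_of_nonneg_left hC0 (Real.sqrt_pos.2 hmpos)
          exact Real.sqrt_le_sqrt hs2
        exact (h1.trans h2).trans (le_max_right _ _)
    have hSerrin : MemLqLp ∞ ∞ κ (Ioo 0 S') := by
      refine memLqLp_of_ae_eLpNorm_le (C := ENNReal.ofReal M) ENNReal.ofReal_ne_top ?_ ?_ ?_
      · rw [Real.volume_Ioo]; exact ENNReal.ofReal_ne_top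
      · refine (ae_restrict_iff' measurableSet_Ioo).2 (Eventually.of_forall fun s hs => ?_)
        exact memLp_top_of_bound (hκ.memLp ⟨hs.1.le, hs.2.trans hS'T⟩).1 M
          ((hUκ s ⟨hs.1.le, hs.2.trans hS'T⟩).mono fun x hx => by rw [← hx]; exact hUM s hs x)
      · refine (ae_restrict_iff' measurableSet_Ioo).2 (Eventually.of_forall fun s hs => ?_)
        rw [eLpNorm_congr_ae (hUκ s ⟨hs.1.le, hs.2.trans hS'T⟩).symm, eLpNorm_exponent_top]
        exact eLpNormEssSup_le_of_ae_bound (Eventually.of_forall fun x => hUM s hs x)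
    -- weak–strong uniqueness on `[0, S']`
    have hqr : 2 / (∞ : ℝ≥0∞) + 3 / (∞ : ℝ≥0∞) ≤ 1 := by simp [ENNReal.div_top]
    exact (weak_strong_uniqueness_holds hν hS'0 hκLH ENNReal.ofNat_lt_top hqr hSerrin
      (huL.isLerayHopfOn hS'0) t ⟨ht.1, htS'.le⟩).trans (hUκ t ⟨ht.1.le, ht.2⟩).symm
  -- ### (7) the velocity `Ũ`, Leray–Hopf on `[0, T]`
  set uL' : ℝ → EuclideanSpace ℝ (Fin 3) → EuclideanSpace ℝ (Fin 3) := Function.update uL 0 u₀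
    with huL'_def
  have huL'LH : IsLerayHopfOn T ν 0 u₀ uL' :=
    isLerayHopfOn_update_zero (huL.isLerayHopfOn hTpos) hu₀2
  set Ut : ℝ → EuclideanSpace ℝ (Fin 3) → EuclideanSpace ℝ (Fin 3) :=
    fun t => if t < T then U t else uL' t with hUt_def
  have hUtU : ∀ t ∈ Ico 0 T, Ut t = U t := fun t ht => by simp only [hUt_def, ht.2, if_true]
  have hUtcl : IsClassicalNSSolutionOn (Ico 0 T) ν 0 Ut P := hU.congr_slices hUtU fun _ _ => rfl
  have hUt0 : Ut 0 = u₀ := by rw [hUtU 0 ⟨le_rfl, hTpos⟩, hU0]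
  have hUtmeas : AEStronglyMeasurable (uncurry Ut) (volume.restrict (Ioo 0 T ×ˢ univ)) := by
    refine (hUmeas T le_rfl).congr ?_
    filter_upwards [ae_restrict_mem (measurableSet_Ioo.prod MeasurableSet.univ)] with z hz
    change U z.1 z.2 = Ut z.1 z.2
    rw [hUtU z.1 ⟨hz.1.1.le, hz.1.2⟩]
  have hUtLH : IsLerayHopfOn T ν 0 u₀ Ut := by
    refine huL'LH.congr_ae_slices hTpos hUtmeas fun t ht => ?_
    by_cases htT : t < T
    · rw [hUtU t ⟨ht.1, htT⟩]
      rcases ht.1.eq_or_lt with h0 | h0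
      · rw [← h0, hU0, huL'_def, Function.update_self]
      · rw [huL'_def, Function.update_of_ne h0.ne']
        exact (hLae t ⟨h0, htT⟩).symm
    · simp only [hUt_def, htT, if_false]
      exact EventuallyEq.rfl
  refine ⟨Ut, P, hUtcl, hUtLH, hUt0, fun t ht => ?_⟩
  rw [hUtU t ht]
  exact hUκ t ht

/-- **Registered anchor `frameOfKato` (closed form of `exists_frame_of_isKatoSolutionOn`).** Every
Kato solution on `[0, T)` from a smooth divergence-free rapidly decaying datum has a classical
representative on `[0, T)`, Leray–Hopf on `[0, T]` from the datum, agreeing with it slice-wise a.e. -/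
theorem frameOfKato : ∀ (ν : ℝ), 0 < ν → ∀ (u₀ : EuclideanSpace ℝ (Fin 3) → EuclideanSpace ℝ (Fin 3)), ContDiff ℝ (⊤ : ℕ∞) u₀ → Literature.Analysis.FluidPDE.NSWave0.IsDivFree u₀ → Literature.Analysis.FluidPDE.HasRapidSpatialDecay u₀ → ∀ (T : ℝ), 0 < T → ∀ (κ : ℝ → EuclideanSpace ℝ (Fin 3) → EuclideanSpace ℝ (Fin 3)), Literature.Analysis.FluidPDE.IsKatoSolutionOn T ν u₀ κ → ∃ (U : ℝ → EuclideanSpace ℝ (Fin 3) → EuclideanSpace ℝ (Fin 3)) (P : ℝ → EuclideanSpace ℝ (Fin 3) → ℝ), Literature.Analysis.FluidPDE.IsClassicalNSSolutionOn (Set.Ico 0 T) ν 0 U P ∧ Literature.Analysis.FluidPDE.IsLerayHopfOn T ν 0 u₀ U ∧ U 0 = u₀ ∧ ∀ t ∈ Set.Ico 0 T, U t =ᵐ[MeasureTheory.volume] κ t :=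
  fun _ hν _ hsm hdiv hdec _ hT _ hκ => exists_frame_of_isKatoSolutionOn hν hsm hdiv hdec hT hκ

end Summit.NavierStokesRegularity.NavierStokesRegularity.Theorems.PlanarEnergyAPriori

end
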